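import Literature.NumberTheory.Automorphic.Liu2021.AppendixC.TowerMorphismRefl
import Literature.NumberTheory.Automorphic.Liu2021.AppendixC.Thm415Pinned
import HarnessLib

/-!
# Pull-back of the Hom-spaces `Hom_𝔾(ι_ℓ∘ω, ℚ̄_ℓ ⊗ H¹_ét(A_∞))` along an étale morphism of towers, and the TRANSFER of a
# Galois scalar down the pull-back — the GENERIC half of step (S5) of the printed proof of [Liu2021] Thm. 4.15

Topic `NumberTheory/Automorphic/Liu2021/AppendixC`; namespace `Literature.NumberTheory.Automorphic.Liu2021.AppendixC`.
One REAL definition (`omegaHomPull`) + THEOREMS; NO named fact, NO instance, NO notation, NO `sorry`; net Literature debt 0;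
nothing of [Liu2021] is asserted.  KEY serial k19 of the cell `hodgecm-mathlib` (A-plan1; crux `HLiu418`, residual
`stub_S_thm415Frobenius` of `Cruxes/HLiu418/Lines/a3_liu418.lean`).

[Liu2021] Thm. 4.15, proof l. 2199–2213: a class of `H¹_ét(A_∞)` for `𝔾 = U(𝕍)` is RESTRICTED along the `E`-morphism of towers
`Sh(G⋆) → Sh(G)` attached to `G⋆ = U(V⋆) × U(V⋆^⊥) ↪ G` and the Galois action is read on the restriction.  The receptacle for
that morphism and its pull-back `etPull : H¹_ét(A_∞) → H¹_ét(A⋆_∞)` is ★ `Sec42Data.EtaleTowerHom` (`AppendixC/TowerMorphism`);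
the Hom-space `Hom_{ℚ̄_ℓ[𝔾]}(ι_ℓ∘ω, ℚ̄_ℓ ⊗ H¹_ét(A_∞))` on which [Thm 4.15] speaks is ★ `EtaleHeckeDatum.omegaHom`
(`AppendixC/Thm415Pinned`).  This file proves the GENERIC bookkeeping of the restriction step, for ARBITRARY data
`M : Sec42Data.EtaleTowerHom Cₛ C Tₛ T φ hφ` (threshold compatibility `φ(K₀⋆) ⊆ K₀`), Hecke data `X`, `Xₛ` INDUCED by the
translates, `ι : ℂ ≃+* ℚ̄_ℓ` and any `ℂ[𝔾]`-module `(W, ρW)`: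

* §1 `EtaleHeckeDatum.IsInducedBy.rhoEt_eq_etHeckeRep` — an induced Hecke datum's action IS ★ `HeckeTranslates.etHeckeRep`
  (both are pinned on the level classes `[ψ]_K`, which exhaust the colimit); hence `EtaleTowerHom.etPull_rhoEt` — the pull-back
  intertwines `X.rhoEt (φ g)` with `Xₛ.rhoEt g` (★ `etPull_etHeckeRep`).
* §2 **`comp_baseChange_etPull_mem_omegaHom`** — for `f ∈ X.omegaHom ι ρW`, the composite `(1 ⊗ etPull) ∘ f` lies in
  `Xₛ.omegaHom ι (ρW ∘ φ)`; packaged as the `ℚ̄_ℓ`-linear map **`omegaHomPull … : X.omegaHom ι ρW →ₗ Xₛ.omegaHom ι (ρW.comp φ)`**.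
* §3 Galois compatibility: `towerRep_baseChange_comp_etPull_apply` (★ `etPull_towerRep`, base-changed) and
  **`scalar_transfer_down`** — if `σ` acts by `c` on `f w` then it acts by `c` on the pulled-back value.
* §4 **`towerRep_eq_smul_of_pull` (THE S5 TRANSFER, load-bearing, 0 facts)** — if the pull-back is INJECTIVE on
  `X.omegaHom ι ρW` (`hinj`, the period/non-vanishing input of (S2)) and `σ` acts by the scalar `c` on every value of every
  `f' ∈ Xₛ.omegaHom ι (ρW ∘ φ)` (`hₛ`, the small-group side (S4)), then `σ` acts by `c` on every value of every
  `f ∈ X.omegaHom ι ρW` — proof: `g := (σ ⊗ 1) ∘ f − c • f` lies in the Hom-space (★ `towerRep_comp_mem_omegaHom`), its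
  pull-back vanishes by `hₛ`, so `g = 0` by `hinj`.
* §4b `towerRep_eq_smul_of_pull_ne_zero` / **`towerRep_eq_smul_of_span_of_pull_ne_zero`** — the PER-`f` shape the
  a3_liu418 (S)-split consumes (A-plan1 v15 `S5Transfer`, token for token up to the leading binder names): `f` spans the Hom-space
  (`hspan`) and has non-zero pull-back (`hne`) ⇒ the pull-back is injective on the Hom-space ⇒ §4.
* §5 Sanity (the KEY's cheapest falsifier): along the identity morphism (★ `EtaleTowerHom.refl`, `AppendixC/TowerMorphismRefl`)
  `hinj` is automatic and the transfer is the tautology.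

## References
* [Liu2021] Y. Liu, *Fourier–Jacobi cycles and arithmetic relative trace formula*, Camb. J. Math. 9 (2021): §4.3 l. 2152–2174
  (the Hom-space and its Galois action), Thm. 4.15 and its proof l. 2185–2213 (restriction along the sub-datum), Thm. 4.18 proof
  l. 2258–2290.
* [Milne2005ShimuraVarieties] J. S. Milne, *Introduction to Shimura varieties* (2005), Thm. 13.6 p. 118 and Rem. 13.8 p. 119
  (morphisms of canonical models compatible with the Hecke action).
* Tree: `AppendixC.TowerMorphism` (★ p640334: `EtaleTowerHom`, `etPull_towerRep`, `etPull_etHeckeRep_apply`),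
  `AppendixC.TowerMorphismRefl` (★: `EtaleTowerHom.refl`, `refl_etPull`), `AppendixC.Thm415Pinned` (★ p593306: `omegaHom`,
  `mem_omegaHom_iff`, `towerRep_comp_mem_omegaHom`), `AppendixC.EtaleHeckeDatumOfTranslates` (`etHeckeRep_toTower`,
  `exists_eq_toTower`), `AppendixC.EtaleBettiComparison` (`EtaleHeckeDatum.IsInducedBy`).
-/

set_option autoImplicit false

noncomputable section

open CategoryTheory NumberField
open scoped TensorProduct

namespace Literature.NumberTheory.Automorphic.Liu2021.AppendixC

open Literature.AlgebraicGeometry.Motives (AbelianVariety)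
open Literature.AlgebraicGeometry.Motives.AbelianVariety (rationalTateModuleMap)

variable {F E : Type} [Field F] [NumberField F] [IsTotallyReal F] [Field E] [NumberField E] [Algebra F E]
  [IsTotallyComplex E] [Algebra.IsQuadraticExtension F E]

/-! ## §1 An INDUCED Hecke datum acts by `etHeckeRep`; the pull-back intertwines the two Hecke actions -/

section Induced

variable {P5 : PropC5Data F E} {iso : ℕ → Prop} {C : Sec42Data P5 iso} {ℓ : ℕ} [Fact ℓ.Prime]

/-- **An induced Hecke datum's action is `etHeckeRep`**: if `X.IsInducedBy T` then `X.rhoEt = T.etHeckeRep ℓ` (both act on a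
level class `[ψ]_K` by `[ᵗV_ℓ(Alb T_g) ψ]_L` for the admissible `L = gKg⁻¹ ∩ K₀` — `IsInducedBy`, ★ `etHeckeRep_toTower` — and
the level classes exhaust `H¹_ét(A_∞)`, ★ `exists_eq_toTower`). [cite: Liu2021, §4.2 l. 2074 and §4.3 l. 2160] -/
theorem Sec42Data.EtaleHeckeDatum.IsInducedBy.rhoEt_eq_etHeckeRep {X : C.EtaleHeckeDatum ℓ} {T : C.HeckeTranslates}
    (hX : X.IsInducedBy T) : X.rhoEt = T.etHeckeRep ℓ := by
  refine MonoidHom.ext fun g => LinearMap.ext fun x => ?_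
  obtain ⟨K, ψ, rfl⟩ := C.exists_eq_toTower ℓ x
  rw [hX g (C5.heckeLevel g K) K (C5.heckeLE_heckeLevel g K) ψ,
    T.etHeckeRep_toTower ℓ g (C5.heckeLE_heckeLevel g K) ψ]

/-- Pointwise form: `X.rhoEt g x = T.etHeckeRep ℓ g x` for an induced datum. [cite: Liu2021, §4.3 l. 2160] -/
theorem Sec42Data.EtaleHeckeDatum.IsInducedBy.rhoEt_apply {X : C.EtaleHeckeDatum ℓ} {T : C.HeckeTranslates}
    (hX : X.IsInducedBy T) (g : C.G) (x : C.etaleH1Tower ℓ) : X.rhoEt g x = T.etHeckeRep ℓ g x := by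
  rw [hX.rhoEt_eq_etHeckeRep]

end Induced

section Pull

variable {P5ₛ P5 : PropC5Data F E} {isoₛ iso : ℕ → Prop}
variable {Cₛ : Sec42Data P5ₛ isoₛ} {C : Sec42Data P5 iso} {Tₛ : Cₛ.HeckeTranslates} {T : C.HeckeTranslates}
variable {φ : Cₛ.G →* C.G} {hφ : Continuous φ} (M : Sec42Data.EtaleTowerHom Cₛ C Tₛ T φ hφ) {ℓ : ℕ} [Fact ℓ.Prime]
variable {X : C.EtaleHeckeDatum ℓ} {Xₛ : Cₛ.EtaleHeckeDatum ℓ}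

/-- **The pull-back intertwines the Hecke actions of two INDUCED data**: `etPull (X.rhoEt (φ g) x) = Xₛ.rhoEt g (etPull x)`
(§1 + ★ `EtaleTowerHom.etPull_etHeckeRep_apply`, granted `φ(K₀⋆) ⊆ K₀`). [cite: Liu2021, §4.3 l. 2160]
[cite: Milne2005ShimuraVarieties, Thm. 13.6 p. 118 and Rem. 13.8 p. 119] -/
theorem Sec42Data.EtaleTowerHom.etPull_rhoEt (hK₀ : (Cₛ.S.K₀.1 : Subgroup Cₛ.G).map φ ≤ C.S.K₀.1)
    (hX : X.IsInducedBy T) (hXₛ : Xₛ.IsInducedBy Tₛ) (g : Cₛ.G) (x : C.etaleH1Tower ℓ) :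
    M.etPull ℓ (X.rhoEt (φ g) x) = Xₛ.rhoEt g (M.etPull ℓ x) := by
  rw [hX.rhoEt_apply, hXₛ.rhoEt_apply, M.etPull_etHeckeRep_apply ℓ hK₀]

/-- The same as an identity of linear maps: `etPull ∘ₗ X.rhoEt (φ g) = Xₛ.rhoEt g ∘ₗ etPull`. [cite: Liu2021, §4.3 l. 2160] -/
theorem Sec42Data.EtaleTowerHom.etPull_comp_rhoEt (hK₀ : (Cₛ.S.K₀.1 : Subgroup Cₛ.G).map φ ≤ C.S.K₀.1)
    (hX : X.IsInducedBy T) (hXₛ : Xₛ.IsInducedBy Tₛ) (g : Cₛ.G) :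
    M.etPull ℓ ∘ₗ X.rhoEt (φ g) = Xₛ.rhoEt g ∘ₗ M.etPull ℓ :=
  LinearMap.ext fun x => M.etPull_rhoEt hK₀ hX hXₛ g x

/-! ## §2 The pull-back of the Hom-space `Hom_𝔾(ι_ℓ∘ω, ℚ̄_ℓ ⊗ H¹_ét(A_∞))` -/

variable (ι : ℂ ≃+* AlgebraicClosure ℚ_[ℓ]) {W : Type} [AddCommGroup W] [Module ℂ W] (ρW : Representation ℂ C.G W)

/-- **Restriction along the tower morphism preserves the Hom-spaces**: for `f ∈ Hom_{ℚ̄_ℓ[𝔾]}(ι_ℓ∘ω, ℚ̄_ℓ ⊗ H¹_ét(A_∞))`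
(`X.omegaHom ι ρW`) the composite `(1 ⊗ etPull) ∘ f` intertwines `ω|_{G⋆}` (along `φ`) with the Hecke action of the small
tower: `(1 ⊗ etPull) ∘ f ∈ Xₛ.omegaHom ι (ρW ∘ φ)` — the step «restrict along `Sh(G⋆) → Sh(G)`» of the printed proof.
[cite: Liu2021, Thm. 4.15 proof l. 2199–2213 and §4.3 l. 2162–2165] -/
theorem comp_baseChange_etPull_mem_omegaHom (hK₀ : (Cₛ.S.K₀.1 : Subgroup Cₛ.G).map φ ≤ C.S.K₀.1)
    (hX : X.IsInducedBy T) (hXₛ : Xₛ.IsInducedBy Tₛ) 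
    {f : W →ₛₗ[(ι : ℂ →+* AlgebraicClosure ℚ_[ℓ])] AlgebraicClosure ℚ_[ℓ] ⊗[ℚ_[ℓ]] C.etaleH1Tower ℓ}
    (hf : f ∈ X.omegaHom ι ρW) :
    ((M.etPull ℓ).baseChange (AlgebraicClosure ℚ_[ℓ])).comp f ∈ Xₛ.omegaHom ι (ρW.comp φ) := by
  intro g w
  have hc := congrArg (LinearMap.baseChange (AlgebraicClosure ℚ_[ℓ])) (M.etPull_comp_rhoEt hK₀ hX hXₛ g)
  rw [LinearMap.baseChange_comp, LinearMap.baseChange_comp] at hc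
  rw [MonoidHom.comp_apply, LinearMap.comp_apply, LinearMap.comp_apply, hf (φ g) w]
  exact LinearMap.congr_fun hc (f w)

/-- **The pull-back `Hom_𝔾(ι_ℓ∘ω, ℚ̄_ℓ ⊗ H¹_ét(A_∞)) → Hom_{𝔾⋆}(ι_ℓ∘ω|_{𝔾⋆}, ℚ̄_ℓ ⊗ H¹_ét(A⋆_∞))`, `f ↦ (1 ⊗ etPull) ∘ f`**, as a
`ℚ̄_ℓ`-linear map between the Hom-spaces (REAL definition). [cite: Liu2021, Thm. 4.15 proof l. 2199–2213 and §4.3 l. 2162–2165] -/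
def omegaHomPull (hK₀ : (Cₛ.S.K₀.1 : Subgroup Cₛ.G).map φ ≤ C.S.K₀.1)
    (hX : X.IsInducedBy T) (hXₛ : Xₛ.IsInducedBy Tₛ) : X.omegaHom ι ρW →ₗ[AlgebraicClosure ℚ_[ℓ]] Xₛ.omegaHom ι (ρW.comp φ) where
  toFun f := ⟨((M.etPull ℓ).baseChange (AlgebraicClosure ℚ_[ℓ])).comp f.1,
    comp_baseChange_etPull_mem_omegaHom M ι ρW hK₀ hX hXₛ f.2⟩
  map_add' f f' := by
    apply Subtype.ext
    simp only [Submodule.coe_add, LinearMap.comp_add]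
  map_smul' c f := by
    apply Subtype.ext
    refine LinearMap.ext fun w => ?_
    simp only [Submodule.coe_smul, RingHom.id_apply, LinearMap.comp_apply, LinearMap.smul_apply, map_smul]

/-- Unfolding: `(omegaHomPull f) = (1 ⊗ etPull) ∘ f` on the underlying semilinear maps. [cite: Liu2021, Thm. 4.15 proof l. 2199–2213] -/
theorem coe_omegaHomPull (hK₀ : (Cₛ.S.K₀.1 : Subgroup Cₛ.G).map φ ≤ C.S.K₀.1)
    (hX : X.IsInducedBy T) (hXₛ : Xₛ.IsInducedBy Tₛ) (f : X.omegaHom ι ρW) :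
    ((omegaHomPull M ι ρW hK₀ hX hXₛ f : Xₛ.omegaHom ι (ρW.comp φ)) :
        W →ₛₗ[(ι : ℂ →+* AlgebraicClosure ℚ_[ℓ])] AlgebraicClosure ℚ_[ℓ] ⊗[ℚ_[ℓ]] Cₛ.etaleH1Tower ℓ) =
      ((M.etPull ℓ).baseChange (AlgebraicClosure ℚ_[ℓ])).comp f.1 := rfl

/-- Unfolding, pointwise: `(omegaHomPull f) w = (1 ⊗ etPull) (f w)`. [cite: Liu2021, Thm. 4.15 proof l. 2199–2213] -/
theorem omegaHomPull_apply (hK₀ : (Cₛ.S.K₀.1 : Subgroup Cₛ.G).map φ ≤ C.S.K₀.1)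
    (hX : X.IsInducedBy T) (hXₛ : Xₛ.IsInducedBy Tₛ) (f : X.omegaHom ι ρW) (w : W) :
    (omegaHomPull M ι ρW hK₀ hX hXₛ f : Xₛ.omegaHom ι (ρW.comp φ)).1 w =
      (M.etPull ℓ).baseChange (AlgebraicClosure ℚ_[ℓ]) (f.1 w) := rfl

/-! ## §3 Galois compatibility of the pull-back; transfer of a scalar DOWN the pull-back -/

/-- `(1 ⊗ σ⋆) ((1 ⊗ etPull) y) = (1 ⊗ etPull) ((1 ⊗ σ) y)` on `ℚ̄_ℓ ⊗ H¹_ét` (★ `etPull_towerRep`, base-changed).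
[cite: Liu2021, §4.3 l. 2158–2160] -/
theorem towerRep_baseChange_etPull_baseChange (σ : Field.absoluteGaloisGroup E)
    (y : AlgebraicClosure ℚ_[ℓ] ⊗[ℚ_[ℓ]] C.etaleH1Tower ℓ) :
    (Cₛ.towerRep ℓ σ).baseChange (AlgebraicClosure ℚ_[ℓ]) ((M.etPull ℓ).baseChange (AlgebraicClosure ℚ_[ℓ]) y) =
      (M.etPull ℓ).baseChange (AlgebraicClosure ℚ_[ℓ]) ((C.towerRep ℓ σ).baseChange (AlgebraicClosure ℚ_[ℓ]) y) := by
  have hc := congrArg (LinearMap.baseChange (AlgebraicClosure ℚ_[ℓ])) (M.etPull_towerRep ℓ σ)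
  rw [LinearMap.baseChange_comp, LinearMap.baseChange_comp] at hc
  exact (LinearMap.congr_fun hc y).symm

/-- **Transfer DOWN**: if `σ` acts by the scalar `c` on `f w` then it acts by `c` on the pulled-back value `(1 ⊗ etPull) (f w)`.
[cite: Liu2021, Thm. 4.15 proof l. 2199–2213] -/
theorem scalar_transfer_down (σ : Field.absoluteGaloisGroup E) (c : AlgebraicClosure ℚ_[ℓ])
    {f : W →ₛₗ[(ι : ℂ →+* AlgebraicClosure ℚ_[ℓ])] AlgebraicClosure ℚ_[ℓ] ⊗[ℚ_[ℓ]] C.etaleH1Tower ℓ} (w : W)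
    (h : (C.towerRep ℓ σ).baseChange (AlgebraicClosure ℚ_[ℓ]) (f w) = c • f w) :
    (Cₛ.towerRep ℓ σ).baseChange (AlgebraicClosure ℚ_[ℓ])
        ((((M.etPull ℓ).baseChange (AlgebraicClosure ℚ_[ℓ])).comp f) w) =
      c • (((M.etPull ℓ).baseChange (AlgebraicClosure ℚ_[ℓ])).comp f) w := by
  rw [LinearMap.comp_apply, towerRep_baseChange_etPull_baseChange, h, map_smul]

/-! ## §4 THE S5 TRANSFER: a Galois scalar on the small Hom-space transfers UP an injective pull-back -/

/-- **Transfer UP an injective pull-back (the generic half of (S5) of the printed proof of [Liu2021] Thm. 4.15).**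
Let the pull-back `f ↦ (1 ⊗ etPull) ∘ f` be INJECTIVE on `Hom_𝔾(ι_ℓ∘ω, ℚ̄_ℓ ⊗ H¹_ét(A_∞))` (`hinj` — in the printed proof:
non-vanishing of the restricted theta periods, step (S2)) and let `σ ∈ Γ_E` act by the scalar `c` on every value of every
element of the small Hom-space `Hom_{𝔾⋆}(ι_ℓ∘ω|_{𝔾⋆}, ℚ̄_ℓ ⊗ H¹_ét(A⋆_∞))` (`hₛ` — the curve/small-group side, step (S4)).
Then `σ` acts by `c` on every value of every `f ∈ Hom_𝔾(ι_ℓ∘ω, ℚ̄_ℓ ⊗ H¹_ét(A_∞))`.  Proof: `g := (σ ⊗ 1) ∘ f − c • f` lies in the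
Hom-space (★ `towerRep_comp_mem_omegaHom`), its pull-back is `(σ⋆ ⊗ 1) ∘ (pull f) − c • pull f = 0` by `hₛ` applied to
`pull f` (§2), hence `g = 0` by `hinj`. [cite: Liu2021, Thm. 4.15 proof l. 2199–2213 and §4.3 l. 2166–2174] -/
theorem towerRep_eq_smul_of_pull (hK₀ : (Cₛ.S.K₀.1 : Subgroup Cₛ.G).map φ ≤ C.S.K₀.1)
    (hX : X.IsInducedBy T) (hXₛ : Xₛ.IsInducedBy Tₛ) (σ : Field.absoluteGaloisGroup E) (c : AlgebraicClosure ℚ_[ℓ])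
    (hinj : ∀ f ∈ X.omegaHom ι ρW, ((M.etPull ℓ).baseChange (AlgebraicClosure ℚ_[ℓ])).comp f = 0 → f = 0)
    (hₛ : ∀ f' ∈ Xₛ.omegaHom ι (ρW.comp φ), ∀ w : W,
      (Cₛ.towerRep ℓ σ).baseChange (AlgebraicClosure ℚ_[ℓ]) (f' w) = c • f' w) :
    ∀ f ∈ X.omegaHom ι ρW, ∀ w : W, (C.towerRep ℓ σ).baseChange (AlgebraicClosure ℚ_[ℓ]) (f w) = c • f w := by
  intro f hf w
  -- `g := (σ ⊗ 1) ∘ f − c • f` lies in the Hom-space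
  set g : W →ₛₗ[(ι : ℂ →+* AlgebraicClosure ℚ_[ℓ])] AlgebraicClosure ℚ_[ℓ] ⊗[ℚ_[ℓ]] C.etaleH1Tower ℓ :=
    ((C.towerRep ℓ σ).baseChange (AlgebraicClosure ℚ_[ℓ])).comp f - c • f with hg_def
  have hg : g ∈ X.omegaHom ι ρW :=
    (X.omegaHom ι ρW).sub_mem (X.towerRep_comp_mem_omegaHom ι ρW hf σ) ((X.omegaHom ι ρW).smul_mem c hf)
  -- its pull-back vanishes: `σ⋆` acts by `c` on `pull f ∈ Xₛ.omegaHom`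
  have hpf : ((M.etPull ℓ).baseChange (AlgebraicClosure ℚ_[ℓ])).comp f ∈ Xₛ.omegaHom ι (ρW.comp φ) :=
    comp_baseChange_etPull_mem_omegaHom M ι ρW hK₀ hX hXₛ hf
  have hpull : ((M.etPull ℓ).baseChange (AlgebraicClosure ℚ_[ℓ])).comp g = 0 := by
    apply LinearMap.ext
    intro w'
    have h' := hₛ _ hpf w'
    rw [LinearMap.comp_apply, towerRep_baseChange_etPull_baseChange] at h'
    rw [LinearMap.zero_apply, LinearMap.comp_apply, hg_def, LinearMap.sub_apply, LinearMap.smul_apply, map_sub, map_smul,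
      LinearMap.comp_apply, h', sub_self]
  -- so `g = 0`
  have hg0 : g = 0 := hinj g hg hpull
  have hw := LinearMap.congr_fun hg0 w
  rw [hg_def, LinearMap.sub_apply, LinearMap.smul_apply, LinearMap.comp_apply, LinearMap.zero_apply, sub_eq_zero] at hw
  exact hw

/-- The transfer in `omegaHomPull` spelling: injectivity of `omegaHomPull` + the scalar on the small side give the scalar on the
big side. [cite: Liu2021, Thm. 4.15 proof l. 2199–2213] -/
theorem towerRep_eq_smul_of_omegaHomPull_injective (hK₀ : (Cₛ.S.K₀.1 : Subgroup Cₛ.G).map φ ≤ C.S.K₀.1)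
    (hX : X.IsInducedBy T) (hXₛ : Xₛ.IsInducedBy Tₛ) (σ : Field.absoluteGaloisGroup E) (c : AlgebraicClosure ℚ_[ℓ])
    (hinj : Function.Injective (omegaHomPull M ι ρW hK₀ hX hXₛ))
    (hₛ : ∀ f' ∈ Xₛ.omegaHom ι (ρW.comp φ), ∀ w : W,
      (Cₛ.towerRep ℓ σ).baseChange (AlgebraicClosure ℚ_[ℓ]) (f' w) = c • f' w)
    (f : X.omegaHom ι ρW) (w : W) :
    (C.towerRep ℓ σ).baseChange (AlgebraicClosure ℚ_[ℓ]) (f.1 w) = c • f.1 w := by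
  refine towerRep_eq_smul_of_pull M ι ρW hK₀ hX hXₛ σ c (fun f₀ hf₀ h0 => ?_) hₛ f.1 f.2 w
  have h1 : omegaHomPull M ι ρW hK₀ hX hXₛ ⟨f₀, hf₀⟩ = 0 := Subtype.ext h0
  have h2 : (⟨f₀, hf₀⟩ : X.omegaHom ι ρW) = 0 := hinj (by rw [h1, map_zero])
  exact congrArg Subtype.val h2


/-- **Per-`f` form of the transfer** (the shape the a3_liu418 (S)-split's S5 node consumes): if `f ∈ X.omegaHom ι ρW` SPANS the
Hom-space (`hspan`, multiplicity ≤ 1) and its pull-back is non-zero (`hne`), then the pull-back is injective on the Hom-space, so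
§4 applies: `σ` acts by `c` on every `f w` as soon as it does on every value of the small Hom-space.
[cite: Liu2021, Thm. 4.15 proof l. 2199–2213] -/
theorem towerRep_eq_smul_of_pull_ne_zero (hK₀ : (Cₛ.S.K₀.1 : Subgroup Cₛ.G).map φ ≤ C.S.K₀.1)
    (hX : X.IsInducedBy T) (hXₛ : Xₛ.IsInducedBy Tₛ) (σ : Field.absoluteGaloisGroup E) (c : AlgebraicClosure ℚ_[ℓ])
    {f : W →ₛₗ[(ι : ℂ →+* AlgebraicClosure ℚ_[ℓ])] AlgebraicClosure ℚ_[ℓ] ⊗[ℚ_[ℓ]] C.etaleH1Tower ℓ}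
    (hf : f ∈ X.omegaHom ι ρW) (hspan : ∀ g ∈ X.omegaHom ι ρW, ∃ b : AlgebraicClosure ℚ_[ℓ], g = b • f)
    (hne : ((M.etPull ℓ).baseChange (AlgebraicClosure ℚ_[ℓ])).comp f ≠ 0)
    (hₛ : ∀ f' ∈ Xₛ.omegaHom ι (ρW.comp φ), ∀ w : W,
      (Cₛ.towerRep ℓ σ).baseChange (AlgebraicClosure ℚ_[ℓ]) (f' w) = c • f' w) :
    ∀ w : W, (C.towerRep ℓ σ).baseChange (AlgebraicClosure ℚ_[ℓ]) (f w) = c • f w := by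
  refine towerRep_eq_smul_of_pull M ι ρW hK₀ hX hXₛ σ c (fun g hg h0 => ?_) hₛ f hf
  obtain ⟨b, rfl⟩ := hspan g hg
  by_cases hb : b = 0
  · rw [hb, zero_smul]
  · exfalso
    apply hne
    have hbf : ((M.etPull ℓ).baseChange (AlgebraicClosure ℚ_[ℓ])).comp (b • f) =
        b • ((M.etPull ℓ).baseChange (AlgebraicClosure ℚ_[ℓ])).comp f :=
      LinearMap.ext fun w => by simp only [LinearMap.comp_apply, LinearMap.smul_apply, map_smul]
    rw [hbf] at h0
    have h1 := congrArg (fun x => b⁻¹ • x) h0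
    simpa only [smul_smul, inv_mul_cancel₀ hb, one_smul, smul_zero] using h1

end Pull

/-! ## §4b The transfer in the universally closed per-`f` shape (all binders explicit, in the order a consumer instantiates) -/

/-- **S5 TRANSFER, universally closed per-`f` form** — for every pair of Appendix-C data, translates, `φ` with `φ(K₀⋆) ⊆ K₀`, étale
tower morphism `M`, induced Hecke data `X`, `Xₛ`, `ι`, `(W, ρW)`, `σ`, `c` and `f ∈ X.omegaHom ι ρW` spanning the Hom-space with
non-zero pull-back: if `σ` acts by `c` on every value of the small Hom-space `Xₛ.omegaHom ι (ρW ∘ φ)` then `σ` acts by `c` on every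
`f w`.  (`towerRep_eq_smul_of_pull_ne_zero` with the binders spelled out.) [cite: Liu2021, Thm. 4.15 proof l. 2199–2213] -/
theorem towerRep_eq_smul_of_span_of_pull_ne_zero
    {P5ₛ P5 : PropC5Data F E} {isoₛ iso : ℕ → Prop}
    (Cₛ : Sec42Data P5ₛ isoₛ) (C : Sec42Data P5 iso) (Tₛ : Cₛ.HeckeTranslates) (T : C.HeckeTranslates)
    (φ : Cₛ.G →* C.G) (hφ : Continuous φ) (hK₀ : (Cₛ.S.K₀.1 : Subgroup Cₛ.G).map φ ≤ C.S.K₀.1)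
    (M : Sec42Data.EtaleTowerHom Cₛ C Tₛ T φ hφ) (ℓ : ℕ) [Fact ℓ.Prime]
    (X : C.EtaleHeckeDatum ℓ) (Xₛ : Cₛ.EtaleHeckeDatum ℓ) (hX : X.IsInducedBy T) (hXₛ : Xₛ.IsInducedBy Tₛ)
    (ι : ℂ ≃+* AlgebraicClosure ℚ_[ℓ]) {W : Type} [AddCommGroup W] [Module ℂ W] (ρW : Representation ℂ C.G W)
    (σ : Field.absoluteGaloisGroup E) (c : AlgebraicClosure ℚ_[ℓ])
    (f : W →ₛₗ[(ι : ℂ →+* AlgebraicClosure ℚ_[ℓ])] AlgebraicClosure ℚ_[ℓ] ⊗[ℚ_[ℓ]] C.etaleH1Tower ℓ)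
    (hf : f ∈ X.omegaHom ι ρW) (hspan : ∀ g ∈ X.omegaHom ι ρW, ∃ b : AlgebraicClosure ℚ_[ℓ], g = b • f)
    (hne : ((M.etPull ℓ).baseChange (AlgebraicClosure ℚ_[ℓ])).comp f ≠ 0)
    (hₛ : ∀ f' ∈ Xₛ.omegaHom ι (ρW.comp φ), ∀ w : W,
      (Cₛ.towerRep ℓ σ).baseChange (AlgebraicClosure ℚ_[ℓ]) (f' w) = c • f' w) :
    ∀ w : W, (C.towerRep ℓ σ).baseChange (AlgebraicClosure ℚ_[ℓ]) (f w) = c • f w :=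
  towerRep_eq_smul_of_pull_ne_zero M ι ρW hK₀ hX hXₛ σ c hf hspan hne hₛ

/-! ## §5 Sanity: along the IDENTITY morphism the pull-back is the identity and the transfer is a tautology -/

section Sanity

variable {P5 : PropC5Data F E} {iso : ℕ → Prop} {C : Sec42Data P5 iso} {T : C.HeckeTranslates} {ℓ : ℕ} [Fact ℓ.Prime]
variable {X : C.EtaleHeckeDatum ℓ} (ι : ℂ ≃+* AlgebraicClosure ℚ_[ℓ]) {W : Type} [AddCommGroup W] [Module ℂ W]
  (ρW : Representation ℂ C.G W)

/-- Along ★ `EtaleTowerHom.refl C T` the pull-back of a Hom is the Hom itself (`etPull = id`). [cite: Liu2021, §4.3 l. 2158] -/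
theorem comp_baseChange_etPull_refl
    (f : W →ₛₗ[(ι : ℂ →+* AlgebraicClosure ℚ_[ℓ])] AlgebraicClosure ℚ_[ℓ] ⊗[ℚ_[ℓ]] C.etaleH1Tower ℓ) :
    (((Sec42Data.EtaleTowerHom.refl C T).etPull ℓ).baseChange (AlgebraicClosure ℚ_[ℓ])).comp f = f := by
  rw [Sec42Data.EtaleTowerHom.refl_etPull, LinearMap.baseChange_id, LinearMap.id_comp]

/-- The KEY's cheapest falsifier, discharged: along the identity morphism (`φ = id`, `etPull = id`) the injectivity hypothesis of
`towerRep_eq_smul_of_pull` is automatic and the conclusion is `hₛ` itself (the small Hom-space is the big one, `ρW ∘ id = ρW`).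
[cite: Liu2021, Thm. 4.15 proof l. 2199–2213] -/
example (hX : X.IsInducedBy T) (σ : Field.absoluteGaloisGroup E) (c : AlgebraicClosure ℚ_[ℓ])
    (hₛ : ∀ f' ∈ X.omegaHom ι (ρW.comp (MonoidHom.id C.G)), ∀ w : W,
      (C.towerRep ℓ σ).baseChange (AlgebraicClosure ℚ_[ℓ]) (f' w) = c • f' w) :
    ∀ f ∈ X.omegaHom ι ρW, ∀ w : W, (C.towerRep ℓ σ).baseChange (AlgebraicClosure ℚ_[ℓ]) (f w) = c • f w :=
  towerRep_eq_smul_of_pull (Sec42Data.EtaleTowerHom.refl C T) ι ρW (le_of_eq (Subgroup.map_id _)) hX hX σ c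
    (fun f _ h0 => by rwa [comp_baseChange_etPull_refl] at h0) hₛ

end Sanity

end Literature.NumberTheory.Automorphic.Liu2021.AppendixC

end
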